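import Summits.QuantumFields.YangMills.Theorems.UnitScaleTiltProp7CovIterLambdaBound
import Literature.MathematicalPhysics.QuantumFieldTheory.Balaban1983to89.B10StarCount
import HarnessLib

/-!
# Route `UnitScaleTilt`, crux K1 «MinimiserStabilityRegPr» (stmt-QuantumFields-19200), route-R [RP] at a curved background — THE CURVED N6,
# ROW (R-B), PART 6g: TWO `ℓ²` LETTERS FOR THE LAST JUNCTION `G_j = S_j + (G_j − S_j)` — the covariant gradient energy is subadditive (Minkowski) and
# crudely bounded by `2√d` times the mass

Cell `ym3-torus`, D-0154 (3c) R3 twin-width seat `ym-routeR-w2` (W-SEAT MAP pass #3 row M9).  The reduced family `G_j` of the curved structure theorem (✓ p606268)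
differs from the pure `LINE`-iterate `S_j` (✓ p615292: the `(√L)^j` law) by `‖G_j − S_j‖_{ℓ²} = O(ε)` (★w2-20520 g3 ✓ p608741); these two letters carry the gradient
bound across: `‖∇^V(X+X′)‖ ≤ ‖∇^VX‖ + ‖∇^VX′‖` and `‖∇^VX′‖ ≤ 2√d‖X′‖`.  THEOREMS ONLY (0 `def`, 0 `sorry`); `--supports stmt-QuantumFields-19200`, count-neutral.  YM₃ on
T³ is a ladder rung (R3), not the Clay problem; nothing here claims the curved N6 bound, S2, P, the crux or the gap.
* `sum_normSq_shift_eq` (`Σ_b‖X(b+e_ν)‖² = Σ_b‖X(b)‖²`), ★ `sqrt_sum_normSq_covGrad_le_mass` (`≤ 2√d·‖X‖`), ★ `sqrt_sum_normSq_covGrad_add_le` (Minkowski).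

References: T. Bałaban, CMP 99 (1985) 75–102 [Balaban1985RegularSpaces] ((1.1) p.76); CMP 95 (1984) 17–40 [Balaban1984PropagatorsI] ((1.18) p.20).
-/

noncomputable section

open scoped BigOperators Matrix.Norms.L2Operator

namespace Summit.QuantumFields.YangMills.Theorems.Prop7CovGradSplit

open Literature.MathematicalPhysics.QuantumFieldTheory.Balaban1983to89
open Finset T4Continuum
open B10StarCount (sum_pbond shiftEquiv)
open Summit.QuantumFields.YangMills.Theorems.Prop7CovIterLambdaBound (sqrt_sum_sq_add_le norm_conj_su_le)

variable {P : Params} {n : Type*} [Fintype n] [DecidableEq n] [Nonempty n] {j : ℕ}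

omit [Nonempty n] in
/-- The bond shift is a bijection: `Σ_b ‖X(b₋+e_ν, dir b)‖² = Σ_b ‖X(b)‖²`. [folklore] -/
theorem sum_normSq_shift_eq (X : PBond P j → Matrix n n ℂ) (ν : Fin P.d) :
    ∑ b : PBond P j, ‖X ⟨b.src.shift ν, b.dir⟩‖ ^ 2 = ∑ b : PBond P j, ‖X b‖ ^ 2 := by
  rw [sum_pbond (fun b : PBond P j => ‖X ⟨b.src.shift ν, b.dir⟩‖ ^ 2), sum_pbond (fun b : PBond P j => ‖X b‖ ^ 2)]
  exact Equiv.sum_comp (shiftEquiv (P := P) (i := j) ν) (fun x => ∑ μ : Fin P.d, ‖X ⟨x, μ⟩‖ ^ 2)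

/-- ★ **THE COVARIANT GRADIENT ENERGY IS CRUDELY BOUNDED BY THE MASS**: `√(Σ_{b,ν}‖V(b₋,ν)X(b+e_ν)V(b₋,ν)* − X(b)‖²) ≤ 2√d·√(Σ_b‖X(b)‖²)`.
[cite: Balaban1985RegularSpaces, (1.1) p.76] -/
theorem sqrt_sum_normSq_covGrad_le_mass (V : GaugeField P j (Matrix.specialUnitaryGroup n ℂ)) (X : PBond P j → Matrix n n ℂ) :
    Real.sqrt (∑ b : PBond P j, ∑ ν : Fin P.d,
        ‖((V ⟨b.src, ν⟩ : Matrix.specialUnitaryGroup n ℂ) : Matrix n n ℂ) * X ⟨b.src.shift ν, b.dir⟩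
            * star ((V ⟨b.src, ν⟩ : Matrix.specialUnitaryGroup n ℂ) : Matrix n n ℂ) - X b‖ ^ 2)
      ≤ 2 * Real.sqrt P.d * Real.sqrt (∑ b : PBond P j, ‖X b‖ ^ 2) := by
  have hpt : ∀ (b : PBond P j) (ν : Fin P.d),
      ‖((V ⟨b.src, ν⟩ : Matrix.specialUnitaryGroup n ℂ) : Matrix n n ℂ) * X ⟨b.src.shift ν, b.dir⟩
          * star ((V ⟨b.src, ν⟩ : Matrix.specialUnitaryGroup n ℂ) : Matrix n n ℂ) - X b‖ ^ 2
        ≤ 2 * ‖X ⟨b.src.shift ν, b.dir⟩‖ ^ 2 + 2 * ‖X b‖ ^ 2 := by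
    intro b ν
    have h1 : ‖((V ⟨b.src, ν⟩ : Matrix.specialUnitaryGroup n ℂ) : Matrix n n ℂ) * X ⟨b.src.shift ν, b.dir⟩
          * star ((V ⟨b.src, ν⟩ : Matrix.specialUnitaryGroup n ℂ) : Matrix n n ℂ) - X b‖ ≤ ‖X ⟨b.src.shift ν, b.dir⟩‖ + ‖X b‖ :=
      (norm_sub_le _ _).trans (add_le_add (norm_conj_su_le _ _) le_rfl)
    have h0 := norm_nonneg (((V ⟨b.src, ν⟩ : Matrix.specialUnitaryGroup n ℂ) : Matrix n n ℂ) * X ⟨b.src.shift ν, b.dir⟩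
          * star ((V ⟨b.src, ν⟩ : Matrix.specialUnitaryGroup n ℂ) : Matrix n n ℂ) - X b)
    nlinarith [sq_nonneg (‖X ⟨b.src.shift ν, b.dir⟩‖ - ‖X b‖), norm_nonneg (X b), norm_nonneg (X ⟨b.src.shift ν, b.dir⟩)]
  have hsum : ∑ b : PBond P j, ∑ ν : Fin P.d,
        ‖((V ⟨b.src, ν⟩ : Matrix.specialUnitaryGroup n ℂ) : Matrix n n ℂ) * X ⟨b.src.shift ν, b.dir⟩
            * star ((V ⟨b.src, ν⟩ : Matrix.specialUnitaryGroup n ℂ) : Matrix n n ℂ) - X b‖ ^ 2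
      ≤ 4 * P.d * ∑ b : PBond P j, ‖X b‖ ^ 2 := by
    calc _ ≤ ∑ b : PBond P j, ∑ ν : Fin P.d, (2 * ‖X ⟨b.src.shift ν, b.dir⟩‖ ^ 2 + 2 * ‖X b‖ ^ 2) :=
          Finset.sum_le_sum fun b _ => Finset.sum_le_sum fun ν _ => hpt b ν
      _ = 2 * ∑ ν : Fin P.d, ∑ b : PBond P j, ‖X ⟨b.src.shift ν, b.dir⟩‖ ^ 2 + 2 * (P.d * ∑ b : PBond P j, ‖X b‖ ^ 2) := by
          rw [Finset.sum_comm]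
          simp only [Finset.sum_add_distrib, Finset.sum_const, Finset.card_univ, Fintype.card_fin, nsmul_eq_mul, ← Finset.mul_sum]
          rw [Finset.sum_comm]
          ring
      _ = 4 * P.d * ∑ b : PBond P j, ‖X b‖ ^ 2 := by
          rw [Finset.sum_congr rfl fun ν _ => sum_normSq_shift_eq X ν, Finset.sum_const, Finset.card_univ, Fintype.card_fin, nsmul_eq_mul]
          ring
  have h0 : 0 ≤ ∑ b : PBond P j, ‖X b‖ ^ 2 := Finset.sum_nonneg fun _ _ => sq_nonneg _
  calc _ ≤ Real.sqrt (4 * P.d * ∑ b : PBond P j, ‖X b‖ ^ 2) := Real.sqrt_le_sqrt hsum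
    _ = 2 * Real.sqrt P.d * Real.sqrt (∑ b : PBond P j, ‖X b‖ ^ 2) := by
        rw [Real.sqrt_mul (by positivity), Real.sqrt_mul (by norm_num), show (4 : ℝ) = 2 ^ 2 by norm_num, Real.sqrt_sq (by norm_num)]

omit [Nonempty n] in
/-- ★ **MINKOWSKI FOR THE COVARIANT GRADIENT ENERGY OF A SUM**: `‖∇^V(X + X′)‖_{ℓ²} ≤ ‖∇^VX‖_{ℓ²} + ‖∇^VX′‖_{ℓ²}`. [folklore] -/
theorem sqrt_sum_normSq_covGrad_add_le (V : GaugeField P j (Matrix.specialUnitaryGroup n ℂ)) (X X' : PBond P j → Matrix n n ℂ) :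
    Real.sqrt (∑ b : PBond P j, ∑ ν : Fin P.d,
        ‖((V ⟨b.src, ν⟩ : Matrix.specialUnitaryGroup n ℂ) : Matrix n n ℂ) * (X ⟨b.src.shift ν, b.dir⟩ + X' ⟨b.src.shift ν, b.dir⟩)
            * star ((V ⟨b.src, ν⟩ : Matrix.specialUnitaryGroup n ℂ) : Matrix n n ℂ) - (X b + X' b)‖ ^ 2)
      ≤ Real.sqrt (∑ b : PBond P j, ∑ ν : Fin P.d,
          ‖((V ⟨b.src, ν⟩ : Matrix.specialUnitaryGroup n ℂ) : Matrix n n ℂ) * X ⟨b.src.shift ν, b.dir⟩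
              * star ((V ⟨b.src, ν⟩ : Matrix.specialUnitaryGroup n ℂ) : Matrix n n ℂ) - X b‖ ^ 2)
        + Real.sqrt (∑ b : PBond P j, ∑ ν : Fin P.d,
          ‖((V ⟨b.src, ν⟩ : Matrix.specialUnitaryGroup n ℂ) : Matrix n n ℂ) * X' ⟨b.src.shift ν, b.dir⟩
              * star ((V ⟨b.src, ν⟩ : Matrix.specialUnitaryGroup n ℂ) : Matrix n n ℂ) - X' b‖ ^ 2) := by
  have hflat : ∀ f : PBond P j → Fin P.d → ℝ, ∑ b : PBond P j, ∑ ν : Fin P.d, f b ν = ∑ q : PBond P j × Fin P.d, f q.1 q.2 :=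
    fun f => (Fintype.sum_prod_type fun q : PBond P j × Fin P.d => f q.1 q.2).symm
  rw [hflat, hflat, hflat]
  have hpt : ∀ q : PBond P j × Fin P.d,
      ‖((V ⟨q.1.src, q.2⟩ : Matrix.specialUnitaryGroup n ℂ) : Matrix n n ℂ) * (X ⟨q.1.src.shift q.2, q.1.dir⟩ + X' ⟨q.1.src.shift q.2, q.1.dir⟩)
          * star ((V ⟨q.1.src, q.2⟩ : Matrix.specialUnitaryGroup n ℂ) : Matrix n n ℂ) - (X q.1 + X' q.1)‖
        ≤ ‖((V ⟨q.1.src, q.2⟩ : Matrix.specialUnitaryGroup n ℂ) : Matrix n n ℂ) * X ⟨q.1.src.shift q.2, q.1.dir⟩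
              * star ((V ⟨q.1.src, q.2⟩ : Matrix.specialUnitaryGroup n ℂ) : Matrix n n ℂ) - X q.1‖
          + ‖((V ⟨q.1.src, q.2⟩ : Matrix.specialUnitaryGroup n ℂ) : Matrix n n ℂ) * X' ⟨q.1.src.shift q.2, q.1.dir⟩
              * star ((V ⟨q.1.src, q.2⟩ : Matrix.specialUnitaryGroup n ℂ) : Matrix n n ℂ) - X' q.1‖ := by
    intro q
    have e : ((V ⟨q.1.src, q.2⟩ : Matrix.specialUnitaryGroup n ℂ) : Matrix n n ℂ) * (X ⟨q.1.src.shift q.2, q.1.dir⟩ + X' ⟨q.1.src.shift q.2, q.1.dir⟩)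
          * star ((V ⟨q.1.src, q.2⟩ : Matrix.specialUnitaryGroup n ℂ) : Matrix n n ℂ) - (X q.1 + X' q.1)
        = (((V ⟨q.1.src, q.2⟩ : Matrix.specialUnitaryGroup n ℂ) : Matrix n n ℂ) * X ⟨q.1.src.shift q.2, q.1.dir⟩
              * star ((V ⟨q.1.src, q.2⟩ : Matrix.specialUnitaryGroup n ℂ) : Matrix n n ℂ) - X q.1)
          + (((V ⟨q.1.src, q.2⟩ : Matrix.specialUnitaryGroup n ℂ) : Matrix n n ℂ) * X' ⟨q.1.src.shift q.2, q.1.dir⟩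
              * star ((V ⟨q.1.src, q.2⟩ : Matrix.specialUnitaryGroup n ℂ) : Matrix n n ℂ) - X' q.1) := by noncomm_ring
    rw [e]; exact norm_add_le _ _
  refine (Real.sqrt_le_sqrt (Finset.sum_le_sum fun q _ => pow_le_pow_left₀ (norm_nonneg _) (hpt q) 2)).trans ?_
  exact sqrt_sum_sq_add_le _ _ _ (fun q _ => norm_nonneg _) (fun q _ => norm_nonneg _)

end Summit.QuantumFields.YangMills.Theorems.Prop7CovGradSplit

end
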